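import Literature.AlgebraicGeometry.AbelianSchemes.PolarizationLawOfSymplecticTowersIndependentRoots
import Literature.AlgebraicGeometry.AbelianSchemes.IdentityFibreTowerTransport
import Literature.AlgebraicGeometry.AbelianSchemes.SerreTensorHomOfIdealFamilyAlgClosed
import Literature.AlgebraicGeometry.AbelianSchemes.AbelianSchemePolarizationBaseChange
import Literature.AlgebraicGeometry.AbelianSchemes.PolarizationUnitHypothesis
import Literature.AlgebraicGeometry.AbelianSchemes.RosatiSpreadStage
import Literature.AlgebraicGeometry.AbelianSchemes.SymplecticLiftOfIsogenyTower
import Literature.AlgebraicGeometry.ModuliOfAbelianVarieties.SiegelAdelicMarkingTorsionTransporter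
import Literature.AlgebraicGeometry.ModuliOfAbelianVarieties.SiegelAdelicMarkingHomIdealFamily
import Literature.AlgebraicGeometry.ModuliOfAbelianVarieties.SiegelAdelicMarkingHomKernel
import Literature.AlgebraicGeometry.ModuliOfAbelianVarieties.SiegelAdelicMarkingUnitFrameTorsionReading
import Literature.NumberTheory.NumberFields.SerreTensorPresentationOfIdeal
import HarnessLib

/-!
# The CENTRAL HECKE ROOF of a marked pair of fibres: `A_{y} —q→ A_{y″} ⊗ 𝔭⁻¹ ←c— A_{y″}` from two admissible readings and their rational transporter

Topic `AlgebraicGeometry/ModuliOfAbelianVarieties`; namespace `Literature.AlgebraicGeometry.ModuliOfAbelianVarieties`.  THEOREMS ONLY (no definition,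
no named fact, no instance, no notation, no `sorry`).  Cell `hodgecm-mathlib` (D-0151), FLOOR 0, P6 «MOD programme» (crux hLiu418 = stmt-HodgeConjecture-24832,
`--supports`, count-neutral), EHECKE closer leaf organ **(O-R2) «central roofs at complex points»** (LA5-plan (g3) skeleton v5 `OrganER2`), generic part;
HC_CM is proved only modulo the printed citations until rung 0 closes.

THE MODULI DESCRIPTION OF A HECKE CORRESPONDENCE AT `p` ([Kottwitz1992] §5 pp. 389–391; [RapoportSmithlingZhang2020Diagonal] §4.3 (4.23) p. 21;
[HarrisTaylorAMS2001] §III.4 pp. 108–110): two complex points `pt₁`, `pt₂` of the base of a polarised abelian scheme `𝒜` with `𝒪_F`-action `ρ` and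
level structure, whose fibres are MARKED (★ `SiegelAdelicMarking`) by `[J₁, r₁]`, `[J₂, r₂]` with admissible readings (ample `Θᵢ` with `λ̄ = Λ(𝒪(Θᵢ))`,
symplectic towers `Λᵢ` read adelically, unit frames `γ = 1`, action readings `Mρᵢ`), and a RATIONAL TRANSPORTER `T` (`ℂ`-linear, `ψ_δ`-symplectic,
intertwining `Mρ₁`, `Mρ₂`, with the lattice law `(T·Mρ₁ π)Λ_{r₁} ⊆ Λ_{r₂}` for `π ∈ 𝔭`, the level law, and the CENTRAL KERNEL LAW
`𝔭⁻¹·T⁻¹Λ_{r₂} = 𝔭′⁻¹Λ_{r₁}`, `𝔭′ = c 𝔭`) are joined by an ISOGENY ROOF `𝒜_{pt₁} —q→ B ←c— 𝒜_{pt₂}` over `Spec ℂ` whose kernels are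
`𝒜_{pt₁}[𝔭′]` and `𝒜_{pt₂}[𝔭]`, with the polarisation, equivariance and level clauses (r1)–(r5) of the cell's `RoofAt`.

* §1 `hsim` — **`comp_lam_comp_dualIsogenyOver_eq_mulN_sq_of_markedReadings`**: a homomorphism `h : 𝒜_{pt₁} ⟶ 𝒜_{pt₂}` reading `p·T` satisfies
  `h ≫ λ₂ ≫ h^∨ = λ₁ ≫ [p²]` — ★ `SiegelAdelicMarking.exists_torsionTransporter` (multiplier `p²·u₁u₂⁻¹`), transported to the identity fibres by ★
  `IdentityFibreTowerTransport`, then ★ `comp_lam_comp_dualIsogenyOver_eq_mulN_of_towerReadings_unit`.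
* §2 **`exists_heckeCentralRoof_of_markedReadings`** — the roof: the `𝔭`-family ★ `SiegelAdelicMarking.exists_idealHomFamily_X` (reading `π ↦ T·Mρ₁ π`), §1 at
  `π = p`, the kernel readers ★ `forall_map_idealHomFamily_eq_one_iff` ∕ ★ `forall_map_eq_one_and_forall_iff`, and the Serre-tensor middle ★
  `AbelianSchemeOver.exists_roof_of_idealHomFamily_of_isAlgClosed`.

References: [Kottwitz1992] R. Kottwitz, JAMS 5 (1992), §5 pp. 389–391; [RapoportSmithlingZhang2020Diagonal] M. Rapoport, B. Smithling, W. Zhang, Compos. Math. 156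
(2020), §4.3 (4.23) p. 21; [HarrisTaylorAMS2001] M. Harris, R. Taylor, Ann. Math. Studies 151 (2001), §III.4 pp. 108–110; [MumfordAV1970] D. Mumford, *Abelian
Varieties* (1970), §20 pp. 184–186, §23 Thm. 2 p. 231; [Milne2005ShimuraVarieties] J. S. Milne, *Introduction to Shimura varieties* (2005), §6 Thm. 6.11 p. 74 and p. 75.
-/

set_option autoImplicit false

noncomputable section

-- Mathlib's `Over`/pull-back API is stated across semireducible wrappers (as in the ★ `AbelianSchemes/*` files).
set_option backward.isDefEq.respectTransparency false

open Matrix CategoryTheory CategoryTheory.Limits AlgebraicGeometry NumberField IsDedekindDomain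
open scoped MonObj
open Literature.AlgebraicGeometry.Motives (AbelianVariety AlgPoints CartierDivisor)
open Literature.AlgebraicGeometry.AbelianSchemes Literature.AlgebraicGeometry.AbelianSchemes.AbelianSchemeOver
open Literature.NumberTheory.Adeles (latticeOfGL mem_integralAdeles_of_forall_valued_eq_one)
open Literature.Geometry.Kaehler (ComplexTorus)

namespace Literature.AlgebraicGeometry.ModuliOfAbelianVarieties

variable {g : ℕ} {δ : Fin g → ℕ}

/-! ## §0 Plumbing: `ẑ`-units of valuation one; the multiplier of `r₂⁻¹ (p·T)^ r₁` -/

/-- A finite idèle of `ℚ` with all valuations `1` is a unit of `ẑ`. [cite: CasselsFrohlichANT1967, Ch. II §16] -/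
theorem exists_units_integralAdeles_coe_eq (u : finAdeleQˣ) (hu : ∀ v, Valued.v ((u : finAdeleQ) v) = 1) :
    ∃ ε : (FiniteAdeleRing.integralAdeles (𝓞 ℚ) ℚ)ˣ, ((ε : FiniteAdeleRing.integralAdeles (𝓞 ℚ) ℚ) : finAdeleQ) = u := by
  have hu' : ∀ v, Valued.v (((u⁻¹ : finAdeleQˣ) : finAdeleQ) v) = 1 := fun v => by
    have h := congrArg (fun x : finAdeleQ => Valued.v (x v)) (u.inv_mul : ((u⁻¹ : finAdeleQˣ) : finAdeleQ) * (u : finAdeleQ) = 1)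
    simp only [Literature.NumberTheory.Automorphic.FiniteAdeleRing.mul_apply', Valuation.map_mul, hu v, mul_one] at h
    rw [h]
    exact Valuation.map_one _
  refine ⟨⟨⟨(u : finAdeleQ), mem_integralAdeles_of_forall_valued_eq_one hu⟩,
    ⟨((u⁻¹ : finAdeleQˣ) : finAdeleQ), mem_integralAdeles_of_forall_valued_eq_one hu'⟩,
    Subtype.ext u.mul_inv, Subtype.ext u.inv_mul⟩, rfl⟩

/-- `E_δ` over `ℚ` is `(typeForm δ).map Int.cast`. [cite: GenestierNgo2020, §1.2] -/
theorem typeFormOver_rat_eq : typeFormOver δ ℚ = (typeForm δ).map (Int.cast : ℤ → ℚ) := rfl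

/-- **The multiplier of `G := r₂⁻¹ · (p·T)^ · r₁`**: if `ᵗT ψ_δ T = ψ_δ` over `ℚ` and `ν(rᵢ) = uᵢ`, then `ᵗG ψ_δ G = (p²·u₁u₂⁻¹)·ψ_δ` over `𝔸_{ℚ,f}`.
[cite: Milne2005ShimuraVarieties, §6 p. 67 (ν(g))] -/
theorem transpose_conj_mul_typeFormOver_mul_conj {r₁ r₂ : gspFinAdelic δ} {u₁ u₂ : finAdeleQˣ}
    (hru₁ : IsMultiplier (typeFormOver δ finAdeleQ) (r₁ : GL (Fin g ⊕ Fin g) finAdeleQ) u₁)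
    (hru₂ : IsMultiplier (typeFormOver δ finAdeleQ) (r₂ : GL (Fin g ⊕ Fin g) finAdeleQ) u₂)
    (T : Matrix (Fin g ⊕ Fin g) (Fin g ⊕ Fin g) ℚ) (hTν : Tᵀ * (typeForm δ).map (Int.cast : ℤ → ℚ) * T = (typeForm δ).map (Int.cast : ℤ → ℚ)) (p : ℕ) :
    ((((r₂⁻¹ : gspFinAdelic δ) : GL (Fin g ⊕ Fin g) finAdeleQ) : Matrix (Fin g ⊕ Fin g) (Fin g ⊕ Fin g) finAdeleQ) * adelicMatrix ((p : ℚ) • T) *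
        (((r₁ : gspFinAdelic δ) : GL (Fin g ⊕ Fin g) finAdeleQ) : Matrix (Fin g ⊕ Fin g) (Fin g ⊕ Fin g) finAdeleQ))ᵀ * typeFormOver δ finAdeleQ *
        ((((r₂⁻¹ : gspFinAdelic δ) : GL (Fin g ⊕ Fin g) finAdeleQ) : Matrix (Fin g ⊕ Fin g) (Fin g ⊕ Fin g) finAdeleQ) * adelicMatrix ((p : ℚ) • T) *
        (((r₁ : gspFinAdelic δ) : GL (Fin g ⊕ Fin g) finAdeleQ) : Matrix (Fin g ⊕ Fin g) (Fin g ⊕ Fin g) finAdeleQ)) =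
      (((p ^ 2 : ℕ) : finAdeleQ) * ((u₁ * u₂⁻¹ : finAdeleQˣ) : finAdeleQ)) • typeFormOver δ finAdeleQ := by
  set R₂ := (((r₂⁻¹ : gspFinAdelic δ) : GL (Fin g ⊕ Fin g) finAdeleQ) : Matrix (Fin g ⊕ Fin g) (Fin g ⊕ Fin g) finAdeleQ) with hR₂
  set R₁ := (((r₁ : gspFinAdelic δ) : GL (Fin g ⊕ Fin g) finAdeleQ) : Matrix (Fin g ⊕ Fin g) (Fin g ⊕ Fin g) finAdeleQ) with hR₁
  set Q := adelicMatrix ((p : ℚ) • T) with hQ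
  set ψ := typeFormOver δ finAdeleQ with hψ
  -- the three similitude laws over `𝔸_f`
  have h₂ : R₂ᵀ * ψ * R₂ = ((u₂⁻¹ : finAdeleQˣ) : finAdeleQ) • ψ := by
    have e : R₂ = (((r₂ : gspFinAdelic δ) : GL (Fin g ⊕ Fin g) finAdeleQ)⁻¹ : GL (Fin g ⊕ Fin g) finAdeleQ) := by rw [hR₂, Subgroup.coe_inv]
    rw [e]; exact isMultiplier_iff.1 hru₂.inv
  have h₁ : R₁ᵀ * ψ * R₁ = (u₁ : finAdeleQ) • ψ := isMultiplier_iff.1 hru₁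
  have hQψ : Qᵀ * ψ * Q = ((p ^ 2 : ℕ) : finAdeleQ) • ψ := by
    have hT' : (adelicMatrix T)ᵀ * ψ * adelicMatrix T = ψ := by
      have e := congrArg (fun M : Matrix (Fin g ⊕ Fin g) (Fin g ⊕ Fin g) ℚ => M.map (algebraMap ℚ finAdeleQ)) hTν
      simp only [Matrix.map_mul, Matrix.transpose_map] at e
      rw [← typeFormOver_rat_eq, typeFormOver_map] at e
      exact e
    have hQ' : Q = (p : finAdeleQ) • adelicMatrix T := by
      rw [hQ]; ext i j
      simp only [adelicMatrix_apply, Matrix.smul_apply, smul_eq_mul, map_mul, map_natCast]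
    rw [hQ', Matrix.transpose_smul, Matrix.smul_mul, Matrix.smul_mul, Matrix.mul_smul, hT', smul_smul, Nat.cast_pow, sq]
  -- assemble
  calc (R₂ * Q * R₁)ᵀ * ψ * (R₂ * Q * R₁)
      = R₁ᵀ * (Qᵀ * (R₂ᵀ * ψ * R₂) * Q) * R₁ := by
        simp only [Matrix.transpose_mul, Matrix.mul_assoc]
    _ = (((p ^ 2 : ℕ) : finAdeleQ) * ((u₁ * u₂⁻¹ : finAdeleQˣ) : finAdeleQ)) • ψ := by
        rw [h₂, Matrix.mul_smul, Matrix.smul_mul, hQψ, smul_smul, Matrix.mul_smul, Matrix.smul_mul, h₁, smul_smul, Units.val_mul]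
        ring_nf

/-! ## §1 `hsim`: a homomorphism reading `p·T` between two admissibly read fibres has `h ≫ λ₂ ≫ h^∨ = λ₁ ≫ [p²]` -/

set_option maxHeartbeats 400000 in
/-- **`h ≫ λ₂ ≫ h^∨ = λ₁ ≫ [p²]` FROM THE READINGS.**  Two complex points `pt₁ pt₂` of the base of `(𝒜, D, λ, φ)`; markings `mᵢ` of the fibres by `[Jᵢ, rᵢ]` with
`ν(rᵢ) = uᵢ` units of valuation one; ample `Θᵢ` with `λ̄ = Λ(𝒪(Θᵢ))` at `ptᵢ` and symplectic towers `Λᵢ` READ through `rᵢ` (`hrdᵢ`); a rational `T` with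
`ᵗT ψ_δ T = ψ_δ` and `(p·T)Λ_{r₁} ⊆ Λ_{r₂}`; a homomorphism `h` of the fibres READING `p·T` (`hh`).  Then, on the base changes `𝒜_{ptᵢ} ∕ Spec ℂ`:
`h ≫ λ_{pt₂} ≫ h^∨ = λ_{pt₁} ≫ [p²]` — the `hsim` binder of ★ `exists_roof_of_idealHomFamily_of_isAlgClosed`.  Road: `h` is an isogeny (★
`isIsogeny_of_forall_map_r_eq`); ★ `exists_torsionTransporter` gives `T̄_M` with `h(Λ₁.lift x) = Λ₂.lift (T̄_M x)` and multiplier `p²·ū_M`; transport towers,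
pairings and `IsLambdaOfAt` to the identity fibres (★ `IdentityFibreTowerTransport`); conclude by ★ `comp_lam_comp_dualIsogenyOver_eq_mulN_of_towerReadings_unit`.
[cite: MumfordAV1970, §20 (pp. 184–186) and §23 Thm. 2 (p. 231)] [cite: Milne2005ShimuraVarieties, §6 Thm. 6.11 p. 74 and p. 75] [cite: Kottwitz1992, §5 p. 390] -/
theorem comp_lam_comp_dualIsogenyOver_eq_mulN_sq_of_markedReadings
    {Y : Scheme.{0}} (𝒜 : AbelianSchemeOver Y) (D : 𝒜.DualPair) (pol : 𝒜.Polarization D) {N : ℕ} (lvl : 𝒜.LevelStructure g N) (hN : N ≠ 0)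
    (pt₁ pt₂ : Spec (.of ℂ) ⟶ Y)
    {J₁ J₂ : C0pm δ} {r₁ r₂ : gspFinAdelic δ}
    (m₁ : SiegelAdelicMarking J₁ r₁ (𝒜.fibre pt₁).toAbelianVariety) (m₂ : SiegelAdelicMarking J₂ r₂ (𝒜.fibre pt₂).toAbelianVariety)
    {u₁ u₂ : finAdeleQˣ} (hu₁ : ∀ v, Valued.v ((u₁ : finAdeleQ) v) = 1) (hu₂ : ∀ v, Valued.v ((u₂ : finAdeleQ) v) = 1)
    (hru₁ : IsMultiplier (typeFormOver δ finAdeleQ) (r₁ : GL (Fin g ⊕ Fin g) finAdeleQ) u₁)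
    (hru₂ : IsMultiplier (typeFormOver δ finAdeleQ) (r₂ : GL (Fin g ⊕ Fin g) finAdeleQ) u₂)
    {Θ₁ : CartierDivisor (𝒜.fibre pt₁).toAbelianVariety.X.left} {Θ₂ : CartierDivisor (𝒜.fibre pt₂).toAbelianVariety.X.left}
    (Λ₁ : lvl.SymplecticLift pt₁ Θ₁ δ) (Λ₂ : lvl.SymplecticLift pt₂ Θ₂ δ) (hamp₁ : Θ₁.IsAmple) (hamp₂ : Θ₂.IsAmple)
    (hΘ₁ : 𝒜.IsLambdaOfAt pt₁ D pol.lam Θ₁) (hΘ₂ : 𝒜.IsLambdaOfAt pt₂ D pol.lam Θ₂)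
    (hrd₁ : ∀ ⦃M : ℕ⦄, N ∣ M → M ≠ 0 → ∀ (y' : Fin g ⊕ Fin g → ZMod M) (w : Fin g ⊕ Fin g → ℚ),
      AdelicCongr (((r₁⁻¹ : gspFinAdelic δ)) : GL (Fin g ⊕ Fin g) finAdeleQ) 1 w (fun i => ((y' i).val : ℚ) / M) →
        ((Λ₁.lift M (Multiplicative.ofAdd y')) : (𝒜.fibre pt₁).toAbelianVariety.Points ℂ) = m₁.r w)
    (hrd₂ : ∀ ⦃M : ℕ⦄, N ∣ M → M ≠ 0 → ∀ (y' : Fin g ⊕ Fin g → ZMod M) (w : Fin g ⊕ Fin g → ℚ),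
      AdelicCongr (((r₂⁻¹ : gspFinAdelic δ)) : GL (Fin g ⊕ Fin g) finAdeleQ) 1 w (fun i => ((y' i).val : ℚ) / M) →
        ((Λ₂.lift M (Multiplicative.ofAdd y')) : (𝒜.fibre pt₂).toAbelianVariety.Points ℂ) = m₂.r w)
    (T : Matrix (Fin g ⊕ Fin g) (Fin g ⊕ Fin g) ℚ) (hTu : IsUnit T)
    (hTν : Tᵀ * (typeForm δ).map (Int.cast : ℤ → ℚ) * T = (typeForm δ).map (Int.cast : ℤ → ℚ))
    {p : ℕ} (hp : p ≠ 0)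
    (hTΛ : ∀ v ∈ latticeOfGL ((r₁ : gspFinAdelic δ) : GL (Fin g ⊕ Fin g) finAdeleQ),
      ((p : ℚ) • T) *ᵥ v ∈ latticeOfGL ((r₂ : gspFinAdelic δ) : GL (Fin g ⊕ Fin g) finAdeleQ))
    (h : (𝒜.fibre pt₁).toAbelianVariety ⟶ (𝒜.fibre pt₂).toAbelianVariety)
    (hh : ∀ v, AlgPoints.map h.hom.hom.hom (m₁.r v) = m₂.r (((p : ℚ) • T) *ᵥ v)) :
    haveI := (pol.baseChange pt₂).isMonHom
    h.hom.hom.hom ≫ (pol.baseChange pt₂).lam ≫ DualPair.dualIsogenyOver h.hom.hom.hom (D.baseChange pt₁) (D.baseChange pt₂) =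
      (pol.baseChange pt₁).lam ≫ (D.baseChange pt₁).hat.mulN (p ^ 2) := by
  classical
  haveI := (pol.baseChange pt₁).isMonHom
  haveI := (pol.baseChange pt₂).isMonHom
  -- `h` is an isogeny (it reads the invertible `p·T`), hence `h_{𝟙}` is dominant and affine
  obtain ⟨Tu, hTu'⟩ := hTu
  have hpQ : (p : ℚ) ≠ 0 := Nat.cast_ne_zero.2 hp
  let q : GL (Fin g ⊕ Fin g) ℚ := Units.map (Matrix.scalar (Fin g ⊕ Fin g)).toMonoidHom (Units.mk0 (p : ℚ) hpQ) * Tu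
  have hq : ((q : GL (Fin g ⊕ Fin g) ℚ) : Matrix (Fin g ⊕ Fin g) (Fin g ⊕ Fin g) ℚ) = (p : ℚ) • T := by
    change Matrix.scalar (Fin g ⊕ Fin g) (p : ℚ) * (Tu : Matrix (Fin g ⊕ Fin g) (Fin g ⊕ Fin g) ℚ) = _
    rw [hTu', Matrix.scalar_apply, ← Matrix.smul_eq_diagonal_mul]
  have hiso : AbelianVariety.IsIsogeny h := m₁.isIsogeny_of_forall_map_r_eq m₂ q h (fun v => by rw [hq]; exact hh v)
  haveI : Surjective (AbelianVariety.Hom.toSchemeHom h) := hiso.1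
  haveI : IsFinite (AbelianVariety.Hom.toSchemeHom h) := hiso.2
  haveI : IsDominant (AbelianVariety.Hom.toSchemeHom (fibreHom h.hom.hom.hom (𝟙 _))) := isDominant_toSchemeHom_fibreHom_id h.hom.hom.hom
  haveI : IsAffineHom (AbelianVariety.Hom.toSchemeHom (fibreHom h.hom.hom.hom (𝟙 _))) := isAffineHom_toSchemeHom_fibreHom_id h.hom.hom.hom
  -- the identity-fibre isomorphisms
  let e₁ := fibreIdIso (𝒜.baseChange pt₁)
  let e₂ := fibreIdIso (𝒜.baseChange pt₂)
  haveI := AbelianVariety.isDominant_toSchemeHom_iso_hom e₁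
  haveI := AbelianVariety.isDominant_toSchemeHom_iso_hom e₂
  -- the torsion transporter
  have hG := entries_mem_integralAdeles_of_forall_mulVec_mem_latticeOfGL ((r₁ : gspFinAdelic δ) : GL (Fin g ⊕ Fin g) finAdeleQ)
    ((r₂ : gspFinAdelic δ) : GL (Fin g ⊕ Fin g) finAdeleQ) ((p : ℚ) • T) hTΛ
  obtain ⟨ε, hε⟩ := exists_units_integralAdeles_coe_eq (u₁ * u₂⁻¹) (fun v => by
    rw [Units.val_mul, Literature.NumberTheory.Automorphic.FiniteAdeleRing.mul_apply', Valuation.map_mul, hu₁]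
    have h := congrArg (fun x : finAdeleQ => Valued.v (x v)) (u₂.inv_mul : ((u₂⁻¹ : finAdeleQˣ) : finAdeleQ) * (u₂ : finAdeleQ) = 1)
    simp only [Literature.NumberTheory.Automorphic.FiniteAdeleRing.mul_apply', Valuation.map_mul, hu₂ v, mul_one] at h
    rw [one_mul, h]; exact Valuation.map_one _)
  have hGE := transpose_conj_mul_typeFormOver_mul_conj hru₁ hru₂ T hTν p
  rw [Subgroup.coe_inv, ← hε] at hGE
  obtain ⟨Tb, hTb, hνTb⟩ := SiegelAdelicMarking.exists_torsionTransporter m₁ m₂ h ((p : ℚ) • T) hh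
    (by simpa only [Subgroup.coe_inv] using hG) ε (by simpa only [Subgroup.coe_inv] using hGE)
    (fun M y' => ((Λ₁.lift M (Multiplicative.ofAdd y')) : (𝒜.fibre pt₁).toAbelianVariety.Points ℂ))
    (fun M y' => ((Λ₂.lift M (Multiplicative.ofAdd y')) : (𝒜.fibre pt₂).toAbelianVariety.Points ℂ)) hrd₁ hrd₂
  -- apply the identity-fibre head
  refine comp_lam_comp_dualIsogenyOver_eq_mulN_of_towerReadings_unit h.hom.hom.hom (D.baseChange pt₁) (D.baseChange pt₂)
    (pol.baseChange pt₁).nonempty_unitHatSlice_iso (pol.baseChange pt₂).nonempty_unitHatSlice_iso (pol.baseChange pt₁).lam (pol.baseChange pt₂).lam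
    (pow_ne_zero 2 hp) hN δ
    (IsLambdaOfAt.toIdentityFibre 𝒜 pt₁ D pol.lam hΘ₁) (IsLambdaOfAt.toIdentityFibre 𝒜 pt₂ D pol.lam hΘ₂)
    (isAmple_pullback_fibreIdIso 𝒜 pt₁ hamp₁) (isAmple_pullback_fibreIdIso 𝒜 pt₂ hamp₂)
    Λ₁.ζ Λ₂.ζ (fun M hNM hM => Λ₁.isPrimitiveRoot_ζ hNM hM) (fun M hNM hM => Λ₂.isPrimitiveRoot_ζ hNM hM)
    (fun M x => ⟨AlgPoints.map e₁.inv.hom.hom.hom (Λ₁.lift M (Multiplicative.ofAdd x)).1,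
      AbelianVariety.map_mem_torsionPoints e₁.inv (Λ₁.lift M (Multiplicative.ofAdd x)).2⟩)
    (fun M hNM hM => surjective_map_isoInv_comp e₁ _
      ((Λ₁.lift_bijective hNM hM).2.comp Multiplicative.ofAdd.surjective))
    (fun M x => ⟨AlgPoints.map e₂.inv.hom.hom.hom (Λ₂.lift M (Multiplicative.ofAdd x)).1,
      AbelianVariety.map_mem_torsionPoints e₂.inv (Λ₂.lift M (Multiplicative.ofAdd x)).2⟩)
    (fun M hNM hMΩ x y => ?_) (fun M hNM hMΩ x y => ?_) Tb (fun M hNM hM x => ?_) hνTb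
  · -- pairing law of tower 1 on the identity fibre
    haveI := AbelianVariety.isDominant_toSchemeHom_zsmul_of_ne_zero ((𝒜.baseChange pt₁).fibre (𝟙 _)).toAbelianVariety hMΩ
    haveI := AbelianVariety.isDominant_toSchemeHom_zsmul_of_ne_zero (𝒜.baseChange pt₁).toAffine.toAbelianVariety hMΩ
    rw [weilPairingLevel_pullback_isoHom_map_isoInv e₁ Θ₁]
    exact Λ₁.pairing hNM hMΩ x y
  · haveI := AbelianVariety.isDominant_toSchemeHom_zsmul_of_ne_zero ((𝒜.baseChange pt₂).fibre (𝟙 _)).toAbelianVariety hMΩ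
    haveI := AbelianVariety.isDominant_toSchemeHom_zsmul_of_ne_zero (𝒜.baseChange pt₂).toAffine.toAbelianVariety hMΩ
    rw [weilPairingLevel_pullback_isoHom_map_isoInv e₂ Θ₂]
    exact Λ₂.pairing hNM hMΩ x y
  · -- the reading law, transported
    change AlgPoints.map (fibreHom h.hom.hom.hom (𝟙 _)).hom.hom.hom (AlgPoints.map e₁.inv.hom.hom.hom _) = AlgPoints.map e₂.inv.hom.hom.hom _
    rw [map_fibreHom_map_fibreIdIso_inv, hTb M hNM hM x]

/-! ## §2 THE CENTRAL ROOF from two admissible readings, the rational transporter and the central kernel law -/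

/-- `(Mρ p)_ℚ = p·1` for a ring homomorphism `Mρ : 𝒪_F → M_{2g}(ℤ)`. [folklore] -/
private theorem map_intCast_ringHom_natCast {F : Type} [Field F] [NumberField F] (Mρ : 𝓞 F →+* Matrix (Fin g ⊕ Fin g) (Fin g ⊕ Fin g) ℤ) (p : ℕ) :
    (Mρ (p : 𝓞 F)).map (Int.cast : ℤ → ℚ) = (p : ℚ) • (1 : Matrix (Fin g ⊕ Fin g) (Fin g ⊕ Fin g) ℚ) := by
  rw [map_natCast]
  ext i j
  rw [Matrix.map_apply, Matrix.natCast_apply, Matrix.smul_apply, Matrix.one_apply]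
  split_ifs <;> simp

/-- `T · (Mρ p)_ℚ = p • T`. [folklore] -/
private theorem mul_map_intCast_ringHom_natCast {F : Type} [Field F] [NumberField F] (Mρ : 𝓞 F →+* Matrix (Fin g ⊕ Fin g) (Fin g ⊕ Fin g) ℤ)
    (T : Matrix (Fin g ⊕ Fin g) (Fin g ⊕ Fin g) ℚ) (p : ℕ) : T * (Mρ (p : 𝓞 F)).map (Int.cast : ℤ → ℚ) = (p : ℚ) • T := by
  rw [map_intCast_ringHom_natCast, Matrix.mul_smul, Matrix.mul_one]

set_option maxHeartbeats 800000 in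
/-- **THE CENTRAL HECKE ROOF OF A MARKED PAIR** ([Kottwitz1992] §5; [RapoportSmithlingZhang2020Diagonal] (4.23); [HarrisTaylorAMS2001] §III.4).  Data: `(𝒜, ρ, D, λ, φ)`
over `Y` with Rosati involution `c` (`hros`), relative dimension `g₀`; complex points `pt₁ pt₂`; unit-frame markings `mᵢ` of the fibres by `[Jᵢ, rᵢ]` (`ν(rᵢ) = uᵢ` of
valuation one) with admissible readings — ample `Θᵢ`, `λ̄ = Λ(𝒪(Θᵢ))`, symplectic towers `Λᵢ` read through `rᵢ` (`hrdᵢ`), action readings `Mρᵢ` on the tori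
(`hactᵢ`), `Mρ₁` `ℂ`-linear (`hMJ₁`); a rational transporter `T` — invertible, `ℂ`-linear (`hTJ`), intertwining (`hTM`), symplectic (`hTν`), with the lattice
law on `𝔭` (`hTΛ`), the level law (`hTlvl`) and the CENTRAL KERNEL LAW `𝔭⁻¹T⁻¹Λ_{r₂} = 𝔭′⁻¹Λ_{r₁}` (`hTΛc`); ideals `𝔭`, `𝔭′ = c 𝔭`, `𝔡` with
`𝔭𝔭′𝔡 = (p)`, `p ∈ 𝔭` prime.  CONCLUSION: the `𝔭′`-torsion `K₂ = 𝒜_{pt₁}[𝔭′](ℂ)` and an isogeny roof `𝒜_{pt₁} —q→ B ←c′— 𝒜_{pt₂}` over `Spec ℂ` with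
(r1) `ker q = K₂`, (r2) `ker c′ = 𝒜_{pt₂}[𝔭]`, `c′` onto, (r3) `q^*λ_B = p·λ_{pt₁}`, `c′^*λ_B = p·λ_{pt₂}`, (r4) `𝒪_F`-equivariance, (r5) level points correspond
— the clauses of the cell's `RoofAt` at `(pt₁, pt₂, K₂)`.  Proof: the `𝔭`-family `h_π` reading `T·Mρ₁ π` (★ `exists_idealHomFamily_X`); `hsim` by §1 at
`π = p`; kernel readers ★ `forall_map_idealHomFamily_eq_one_iff` (twice) joined by `hTΛc`; level law through the towers at `M = N`; Serre presentation of `𝔭`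
(★ `exists_serrePresentation_of_ideal_of_natCast_mem`); middle and clauses by ★ `exists_roof_of_idealHomFamily_of_isAlgClosed`.
[cite: Kottwitz1992, §5 pp. 389–391] [cite: RapoportSmithlingZhang2020Diagonal, §4.3 (4.23) p. 21] [cite: HarrisTaylorAMS2001, §III.4, pp. 108–110]
[cite: MumfordAV1970, §23 Thm. 2 p. 231] [cite: Milne2005ShimuraVarieties, §6 Thm. 6.11 p. 74 and p. 75] -/
theorem exists_heckeCentralRoof_of_markedReadings
    {Y : Scheme.{0}} (𝒜 : AbelianSchemeOver Y) {F : Type} [Field F] [NumberField F]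
    (ρ : AbelianSchemeOver.RingAction (𝓞 F) 𝒜) (D : 𝒜.DualPair) (pol : 𝒜.Polarization D) {N : ℕ} (lvl : 𝒜.LevelStructure g N) (hN : N ≠ 0)
    {g₀ : ℕ} (hrel : 𝒜.IsOfRelDim g₀) (c : 𝓞 F ≃+* 𝓞 F) (hcc : ∀ y, c (c y) = y)
    (hros : ∀ b : 𝓞 F, haveI := ρ.isMonHom b; ρ.i (c b) ≫ pol.lam = pol.lam ≫ DualPair.dualIsogenyOver (ρ.i b) D D)
    (pt₁ pt₂ : Spec (.of ℂ) ⟶ Y)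
    {J₁ J₂ : C0pm δ} {r₁ r₂ : gspFinAdelic δ}
    (m₁ : SiegelAdelicMarking J₁ r₁ (𝒜.fibre pt₁).toAbelianVariety) (m₂ : SiegelAdelicMarking J₂ r₂ (𝒜.fibre pt₂).toAbelianVariety)
    (hγ₁ : m₁.γ = 1) (hγ₂ : m₂.γ = 1)
    {u₁ u₂ : finAdeleQˣ} (hu₁ : ∀ v, Valued.v ((u₁ : finAdeleQ) v) = 1) (hu₂ : ∀ v, Valued.v ((u₂ : finAdeleQ) v) = 1)
    (hru₁ : IsMultiplier (typeFormOver δ finAdeleQ) (r₁ : GL (Fin g ⊕ Fin g) finAdeleQ) u₁)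
    (hru₂ : IsMultiplier (typeFormOver δ finAdeleQ) (r₂ : GL (Fin g ⊕ Fin g) finAdeleQ) u₂)
    {Θ₁ : CartierDivisor (𝒜.fibre pt₁).toAbelianVariety.X.left} {Θ₂ : CartierDivisor (𝒜.fibre pt₂).toAbelianVariety.X.left}
    (Λ₁ : lvl.SymplecticLift pt₁ Θ₁ δ) (Λ₂ : lvl.SymplecticLift pt₂ Θ₂ δ) (hamp₁ : Θ₁.IsAmple) (hamp₂ : Θ₂.IsAmple)
    (hΘ₁ : 𝒜.IsLambdaOfAt pt₁ D pol.lam Θ₁) (hΘ₂ : 𝒜.IsLambdaOfAt pt₂ D pol.lam Θ₂)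
    (hrd₁ : ∀ ⦃M : ℕ⦄, N ∣ M → M ≠ 0 → ∀ (y' : Fin g ⊕ Fin g → ZMod M) (w : Fin g ⊕ Fin g → ℚ),
      AdelicCongr (((r₁⁻¹ : gspFinAdelic δ)) : GL (Fin g ⊕ Fin g) finAdeleQ) 1 w (fun i => ((y' i).val : ℚ) / M) →
        ((Λ₁.lift M (Multiplicative.ofAdd y')) : (𝒜.fibre pt₁).toAbelianVariety.Points ℂ) = m₁.r w)
    (hrd₂ : ∀ ⦃M : ℕ⦄, N ∣ M → M ≠ 0 → ∀ (y' : Fin g ⊕ Fin g → ZMod M) (w : Fin g ⊕ Fin g → ℚ),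
      AdelicCongr (((r₂⁻¹ : gspFinAdelic δ)) : GL (Fin g ⊕ Fin g) finAdeleQ) 1 w (fun i => ((y' i).val : ℚ) / M) →
        ((Λ₂.lift M (Multiplicative.ofAdd y')) : (𝒜.fibre pt₂).toAbelianVariety.Points ℂ) = m₂.r w)
    (Mρ₁ Mρ₂ : 𝓞 F →+* Matrix (Fin g ⊕ Fin g) (Fin g ⊕ Fin g) ℤ)
    (hact₁ : ∀ (b : 𝓞 F) (s : ComplexTorus m₁.Ψ), haveI := ρ.isMonHom b
      AlgPoints.map (fibreHom (ρ.i b) pt₁).hom.hom.hom (m₁.toFun s) = m₁.toFun (ComplexTorus.mapMatrix m₁.Ψ m₁.Ψ (Mρ₁ b) s))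
    (hact₂ : ∀ (b : 𝓞 F) (s : ComplexTorus m₂.Ψ), haveI := ρ.isMonHom b
      AlgPoints.map (fibreHom (ρ.i b) pt₂).hom.hom.hom (m₂.toFun s) = m₂.toFun (ComplexTorus.mapMatrix m₂.Ψ m₂.Ψ (Mρ₂ b) s))
    (hMJ₁ : ∀ b : 𝓞 F, (Mρ₁ b).map (Int.cast : ℤ → ℝ) * (J₁ : Matrix (Fin g ⊕ Fin g) (Fin g ⊕ Fin g) ℝ) =
      (J₁ : Matrix (Fin g ⊕ Fin g) (Fin g ⊕ Fin g) ℝ) * (Mρ₁ b).map (Int.cast : ℤ → ℝ))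
    (T : Matrix (Fin g ⊕ Fin g) (Fin g ⊕ Fin g) ℚ) (hTu : IsUnit T)
    (hTJ : T.map (algebraMap ℚ ℝ) * (J₁ : Matrix (Fin g ⊕ Fin g) (Fin g ⊕ Fin g) ℝ) = (J₂ : Matrix (Fin g ⊕ Fin g) (Fin g ⊕ Fin g) ℝ) * T.map (algebraMap ℚ ℝ))
    (hTM : ∀ b : 𝓞 F, T * (Mρ₁ b).map (Int.cast : ℤ → ℚ) = (Mρ₂ b).map (Int.cast : ℤ → ℚ) * T)
    (hTν : Tᵀ * (typeForm δ).map (Int.cast : ℤ → ℚ) * T = (typeForm δ).map (Int.cast : ℤ → ℚ))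
    (𝔭 𝔭' 𝔡 : Ideal (𝓞 F)) (h𝔭c : 𝔭.map (c : 𝓞 F →+* 𝓞 F) = 𝔭') {p : ℕ} (hp : p.Prime) (hp𝔭 : (p : 𝓞 F) ∈ 𝔭) (h𝔭0 : 𝔭 ≠ ⊥)
    (hpd : 𝔭 * 𝔭' * 𝔡 = Ideal.span {(p : 𝓞 F)})
    (hTΛ : ∀ π ∈ 𝔭, ∀ z ∈ latticeOfGL ((r₁ : gspFinAdelic δ) : GL (Fin g ⊕ Fin g) finAdeleQ),
      (T * (Mρ₁ π).map (Int.cast : ℤ → ℚ)) *ᵥ z ∈ latticeOfGL ((r₂ : gspFinAdelic δ) : GL (Fin g ⊕ Fin g) finAdeleQ))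
    (hTlvl : ∀ (y' : Fin g ⊕ Fin g → ZMod N) (w₁ w₂ : Fin g ⊕ Fin g → ℚ),
      AdelicCongr (((r₁⁻¹ : gspFinAdelic δ)) : GL (Fin g ⊕ Fin g) finAdeleQ) 1 w₁ (fun i => ((y' i).val : ℚ) / N) →
      AdelicCongr (((r₂⁻¹ : gspFinAdelic δ)) : GL (Fin g ⊕ Fin g) finAdeleQ) 1 w₂ (fun i => ((y' i).val : ℚ) / N) →
      ∀ π ∈ 𝔭, (T * (Mρ₁ π).map (Int.cast : ℤ → ℚ)) *ᵥ w₁ - ((Mρ₂ π).map (Int.cast : ℤ → ℚ)) *ᵥ w₂ ∈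
        latticeOfGL ((r₂ : gspFinAdelic δ) : GL (Fin g ⊕ Fin g) finAdeleQ))
    (hTΛc : ∀ v : Fin g ⊕ Fin g → ℚ,
      (∀ π ∈ 𝔭, (T * (Mρ₁ π).map (Int.cast : ℤ → ℚ)) *ᵥ v ∈ latticeOfGL ((r₂ : gspFinAdelic δ) : GL (Fin g ⊕ Fin g) finAdeleQ)) ↔
      (∀ a ∈ 𝔭', ((Mρ₁ a).map (Int.cast : ℤ → ℚ)) *ᵥ v ∈ latticeOfGL ((r₁ : gspFinAdelic δ) : GL (Fin g ⊕ Fin g) finAdeleQ))) :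
    ∃ K₂ : Subgroup ((𝒜.fibre pt₁).toAbelianVariety.Points ℂ),
      (∀ P, P ∈ K₂ ↔ ∀ a ∈ 𝔭', haveI := ρ.isMonHom a
        (AlgPoints.map (fibreHom (ρ.i a) pt₁).hom.hom.hom P : (𝒜.fibre pt₁).toAbelianVariety.Points ℂ) = 1) ∧
      ∃ (B : AbelianSchemeOver (Spec (.of ℂ))) (DB : B.DualPair) (lamB : B.X ⟶ DB.hat.X) (_ : IsMonHom lamB)
        (_ : Nonempty ((Scheme.Modules.pullback DB.unitHatSlice).obj DB.P ≅ SheafOfModules.unit _))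
        (q : (𝒜.baseChange pt₁).X ⟶ B.X) (_ : IsMonHom q) (c' : (𝒜.baseChange pt₂).X ⟶ B.X) (_ : IsMonHom c'),
        (∀ P : (𝒜.fibre pt₁).toAbelianVariety.Points ℂ, (AlgPoints.map q P : B.toAffine.toAbelianVariety.Points ℂ) = 1 ↔ P ∈ K₂) ∧
        (∀ P : (𝒜.fibre pt₂).toAbelianVariety.Points ℂ, (AlgPoints.map c' P : B.toAffine.toAbelianVariety.Points ℂ) = 1 ↔
          ∀ a ∈ 𝔭, haveI := ρ.isMonHom a
            (AlgPoints.map (fibreHom (ρ.i a) pt₂).hom.hom.hom P : (𝒜.fibre pt₂).toAbelianVariety.Points ℂ) = 1) ∧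
        Function.Surjective c'.left.base ∧
        (haveI := (pol.baseChange pt₁).isMonHom
         q ≫ lamB ≫ DualPair.dualIsogenyOver q (D.baseChange pt₁) DB = (pol.baseChange pt₁).lam ≫ (D.baseChange pt₁).hat.mulN p) ∧
        (haveI := (pol.baseChange pt₂).isMonHom
         c' ≫ lamB ≫ DualPair.dualIsogenyOver c' (D.baseChange pt₂) DB = (pol.baseChange pt₂).lam ≫ (D.baseChange pt₂).hat.mulN p) ∧
        (∀ a : 𝓞 F, ∃ b : B.X ⟶ B.X, haveI := ρ.isMonHom a
          (fibreHom (ρ.i a) pt₁).hom.hom.hom ≫ q = q ≫ b ∧ (fibreHom (ρ.i a) pt₂).hom.hom.hom ≫ c' = c' ≫ b) ∧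
        (∀ a : Fin g ⊕ Fin g → ZMod N, (AlgPoints.map q (𝒜.restrictPt pt₁ (lvl.section_ a)) : B.toAffine.toAbelianVariety.Points ℂ) =
          AlgPoints.map c' (𝒜.restrictPt pt₂ (lvl.section_ a))) := by
  classical
  haveI := (pol.baseChange pt₁).isMonHom
  haveI := (pol.baseChange pt₂).isMonHom
  haveI : NeZero N := ⟨hN⟩
  haveI : IsCommMonObj (𝒜.baseChange pt₂).X := (𝒜.baseChange pt₂).isCommMonObj_of_isReduced_base
  have hpQ : (p : ℚ) ≠ 0 := Nat.cast_ne_zero.2 hp.ne_zero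
  -- `p ∈ 𝔭′ = c 𝔭`
  have hp𝔭' : (p : 𝓞 F) ∈ 𝔭' := by
    rw [← h𝔭c, ← map_natCast (c : 𝓞 F →+* 𝓞 F) p]
    exact Ideal.mem_map_of_mem _ hp𝔭
  -- the two action families on the fibres and their torsion readings
  let ι₁ : 𝓞 F → ((𝒜.fibre pt₁).toAbelianVariety ⟶ (𝒜.fibre pt₁).toAbelianVariety) := fun b =>
    haveI := ρ.isMonHom b
    fibreHom (ρ.i b) pt₁
  let ι₂ : 𝓞 F → ((𝒜.fibre pt₂).toAbelianVariety ⟶ (𝒜.fibre pt₂).toAbelianVariety) := fun b =>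
    haveI := ρ.isMonHom b
    fibreHom (ρ.i b) pt₂
  have hι₁ : ∀ (b : 𝓞 F) (v : Fin g ⊕ Fin g → ℚ),
      AlgPoints.map (ι₁ b).hom.hom.hom (m₁.r v) = m₁.r ((Mρ₁ b).map (Int.cast : ℤ → ℚ) *ᵥ v) := fun b v =>
    m₁.map_r_eq_of_map_toFun_mapMatrix hγ₁ (ι₁ b) (Mρ₁ b) (hact₁ b) v
  have hι₂ : ∀ (b : 𝓞 F) (v : Fin g ⊕ Fin g → ℚ),
      AlgPoints.map (ι₂ b).hom.hom.hom (m₂.r v) = m₂.r ((Mρ₂ b).map (Int.cast : ℤ → ℚ) *ᵥ v) := fun b v =>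
    m₂.map_r_eq_of_map_toFun_mapMatrix hγ₂ (ι₂ b) (Mρ₂ b) (hact₂ b) v
  -- (O-HF) the `𝔭`-family of marked homomorphisms
  obtain ⟨hf, hread, hmon, hadd, hlin, heq⟩ :=
    SiegelAdelicMarking.exists_idealHomFamily_X m₁ m₂ 𝔭 ι₁ Mρ₁ hι₁ ι₂ Mρ₂ hι₂ T hTJ hTM hMJ₁ hTΛ
  -- the invertible readings `p·T` of `h_p` and `p·1` of `ι₁ p`
  obtain ⟨Tu, hTu'⟩ := hTu
  let q₀ : GL (Fin g ⊕ Fin g) ℚ := Units.map (Matrix.scalar (Fin g ⊕ Fin g)).toMonoidHom (Units.mk0 (p : ℚ) hpQ) * Tu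
  have hq₀ : ((q₀ : GL (Fin g ⊕ Fin g) ℚ) : Matrix (Fin g ⊕ Fin g) (Fin g ⊕ Fin g) ℚ) = T * (Mρ₁ (p : 𝓞 F)).map (Int.cast : ℤ → ℚ) := by
    rw [mul_map_intCast_ringHom_natCast]
    change Matrix.scalar (Fin g ⊕ Fin g) (p : ℚ) * (Tu : Matrix (Fin g ⊕ Fin g) (Fin g ⊕ Fin g) ℚ) = _
    rw [hTu', Matrix.scalar_apply, ← Matrix.smul_eq_diagonal_mul]
  let q₁ : GL (Fin g ⊕ Fin g) ℚ := Units.map (Matrix.scalar (Fin g ⊕ Fin g)).toMonoidHom (Units.mk0 (p : ℚ) hpQ)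
  have hq₁ : ((q₁ : GL (Fin g ⊕ Fin g) ℚ) : Matrix (Fin g ⊕ Fin g) (Fin g ⊕ Fin g) ℚ) = (Mρ₁ (p : 𝓞 F)).map (Int.cast : ℤ → ℚ) := by
    rw [map_intCast_ringHom_natCast]
    change Matrix.scalar (Fin g ⊕ Fin g) (p : ℚ) = _
    rw [Matrix.scalar_apply, Matrix.smul_one_eq_diagonal]
  -- THE KERNEL `K₂ = 𝒜_{pt₁}[𝔭′]`
  let K₂ : Subgroup ((𝒜.fibre pt₁).toAbelianVariety.Points ℂ) :=
    ⨅ (a : 𝓞 F) (_ : a ∈ 𝔭'), (MonoidHom.mk' (fun P => (AlgPoints.map (ι₁ a).hom.hom.hom P : (𝒜.fibre pt₁).toAbelianVariety.Points ℂ))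
      (fun P Q => map_mul_of_isMonHom (ι₁ a).hom.hom.hom P Q)).ker
  have hK₂ : ∀ P, P ∈ K₂ ↔ ∀ a ∈ 𝔭', (AlgPoints.map (ι₁ a).hom.hom.hom P : (𝒜.fibre pt₁).toAbelianVariety.Points ℂ) = 1 := fun P => by
    simp only [K₂, Subgroup.mem_iInf, MonoidHom.mem_ker, MonoidHom.mk'_apply]
  -- kernel readers: `K₂` is the kernel of the family
  have hK : ∀ P, P ∈ K₂ ↔ ∀ π ∈ 𝔭, (AlgPoints.map (hf π).hom.hom.hom P : (𝒜.fibre pt₂).toAbelianVariety.Points ℂ) = 1 := by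
    intro P
    rw [hK₂ P]
    have r₁' := SiegelAdelicMarking.forall_map_idealHomFamily_eq_one_iff m₁ m₁ (𝔭' : Set (𝓞 F)) ι₁ (fun a => (Mρ₁ a).map (Int.cast : ℤ → ℚ))
      (fun a _ v => hι₁ a v) hp𝔭' q₁ hq₁ P
    have r₂' := SiegelAdelicMarking.forall_map_idealHomFamily_eq_one_iff m₁ m₂ (𝔭 : Set (𝓞 F)) hf (fun π => T * (Mρ₁ π).map (Int.cast : ℤ → ℚ))
      hread hp𝔭 q₀ hq₀ P
    simp only [SetLike.mem_coe] at r₁' r₂'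
    rw [r₁', r₂']
    exact exists_congr fun v => and_congr_right fun _ => (hTΛc v).symm
  -- `hsim` at `π = p`
  have hreadp : ∀ v, AlgPoints.map (hf (p : 𝓞 F)).hom.hom.hom (m₁.r v) = m₂.r (((p : ℚ) • T) *ᵥ v) := fun v => by
    rw [hread (p : 𝓞 F) hp𝔭 v, mul_map_intCast_ringHom_natCast]
  have hTΛp : ∀ v ∈ latticeOfGL ((r₁ : gspFinAdelic δ) : GL (Fin g ⊕ Fin g) finAdeleQ),
      ((p : ℚ) • T) *ᵥ v ∈ latticeOfGL ((r₂ : gspFinAdelic δ) : GL (Fin g ⊕ Fin g) finAdeleQ) := fun v hv => by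
    rw [← mul_map_intCast_ringHom_natCast Mρ₁ T p]
    exact hTΛ (p : 𝓞 F) hp𝔭 v hv
  have hsim := comp_lam_comp_dualIsogenyOver_eq_mulN_sq_of_markedReadings 𝒜 D pol lvl hN pt₁ pt₂ m₁ m₂ hu₁ hu₂ hru₁ hru₂ Λ₁ Λ₂ hamp₁ hamp₂ hΘ₁ hΘ₂
    hrd₁ hrd₂ T ⟨Tu, hTu'⟩ hTν hp.ne_zero hTΛp (hf (p : 𝓞 F)) hreadp
  -- the level law through the towers at `M = N`
  have hlvl : ∀ (a : Fin g ⊕ Fin g → ZMod N), ∀ π ∈ 𝔭,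
      (AlgPoints.map (hf π).hom.hom.hom (𝒜.restrictPt pt₁ (lvl.section_ a)) : (𝒜.baseChange pt₂).toAffine.toAbelianVariety.Points ℂ) =
        AlgPoints.map ((ρ.baseChange pt₂).i π) (𝒜.restrictPt pt₂ (lvl.section_ a)) := by
    intro a π hπ
    obtain ⟨w₁, hw₁⟩ := SiegelAdelicMarking.exists_adelicCongr_inv_one (a := r₁) (fun i => ((a i).val : ℚ) / N)
    obtain ⟨w₂, hw₂⟩ := SiegelAdelicMarking.exists_adelicCongr_inv_one (a := r₂) (fun i => ((a i).val : ℚ) / N)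
    have e₁ : 𝒜.restrictPt pt₁ (lvl.section_ a) = m₁.r w₁ := by
      rw [← Λ₁.coe_lift_ofAdd_eq_restrictPt_section]; exact hrd₁ dvd_rfl hN a w₁ hw₁
    have e₂ : 𝒜.restrictPt pt₂ (lvl.section_ a) = m₂.r w₂ := by
      rw [← Λ₂.coe_lift_ofAdd_eq_restrictPt_section]; exact hrd₂ dvd_rfl hN a w₂ hw₂
    rw [e₁, e₂, hread π hπ w₁]
    change _ = AlgPoints.map (ι₂ π).hom.hom.hom (m₂.r w₂)
    rw [hι₂ π w₂, SiegelAdelicMarking.r_eq_r_iff_sub_mem_latticeOfGL]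
    exact hTlvl a w₁ w₂ hw₁ hw₂ π hπ
  -- the Serre presentation of `𝔭`
  obtain ⟨mS, E', hE', P, Q, hP, hQ, hQP, hPQ, h𝔭gen, -, -⟩ :=
    Literature.NumberTheory.NumberFields.SerrePresentation.exists_serrePresentation_of_ideal_of_natCast_mem 𝔭 h𝔭0 hp𝔭
  -- Rosati on the fibre, character, `𝔭·c𝔭·𝔡 = (p)`
  have hros' : ∀ b : 𝓞 F, haveI := (ρ.baseChange pt₂).isMonHom b
      (ρ.baseChange pt₂).i (c b) ≫ (pol.baseChange pt₂).lam =
        (pol.baseChange pt₂).lam ≫ DualPair.dualIsogenyOver ((ρ.baseChange pt₂).i b) (D.baseChange pt₂) (D.baseChange pt₂) := fun b =>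
    RingAction.rosati_baseChange pt₂ ρ D pol.lam b (c b) (hros b)
  have hchar : ∀ l : ℕ, l.Prime → (l : ℂ) = 0 → l ∣ 1 := fun l hl h0 => absurd h0 (Nat.cast_ne_zero.2 hl.ne_zero)
  have hpd' : 𝔭 * 𝔭.map (c : 𝓞 F →+* 𝓞 F) * 𝔡 = Ideal.span {((p : ℕ) : 𝓞 F)} := by rw [h𝔭c]; exact hpd
  -- THE ROOF
  obtain ⟨B, DB, lamB, hlamB, hDB, q, hq, c', hc', hr1, hr2, hsurj, hr3q, hr3c, hr4, hr5⟩ :=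
    exists_roof_of_idealHomFamily_of_isAlgClosed (A₁ := 𝒜.baseChange pt₁) (A₂ := 𝒜.baseChange pt₂)
      (fun a => (ι₁ a).hom.hom.hom) (ρ.baseChange pt₂) c (fun π => (hf π).hom.hom.hom) E' hE' P Q
      (D.baseChange pt₁) (D.baseChange pt₂) (pol.baseChange pt₁).nonempty_unitHatSlice_iso (pol.baseChange pt₂).nonempty_unitHatSlice_iso
      (pol.baseChange pt₁).lam (pol.baseChange pt₂).lam
      (fun a : Fin g ⊕ Fin g → ZMod N => 𝒜.restrictPt pt₁ (lvl.section_ a)) (fun a => 𝒜.restrictPt pt₂ (lvl.section_ a))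
      (fun Pt => ∀ a ∈ 𝔭, (AlgPoints.map (ι₂ a).hom.hom.hom Pt : (𝒜.fibre pt₂).toAbelianVariety.Points ℂ) = 1) K₂
      (hrel.baseChange pt₂) (fun Ω' _ _ s => (pol.baseChange pt₂).exists_ample Ω' s) hcc hros' h𝔭0 one_ne_zero hchar 𝔡 hpd'
      hp.ne_zero hP hQ hQP hPQ h𝔭gen hmon hadd hlin heq hsim hlvl hK (fun Pt => Iff.rfl)
  exact ⟨K₂, hK₂, B, DB, lamB, hlamB, hDB, q, hq, c', hc', hr1, hr2, hsurj, hr3q, hr3c, hr4, hr5⟩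

end Literature.AlgebraicGeometry.ModuliOfAbelianVarieties

end
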